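import Summits.Ventures.CertifiedManyBodySolver.Downfold.EmeryZoneOrbitalContentCert
import HarnessLib

/-!
# THE ORBITAL PARTITION OF THE HOLES OVER THE ZONE, IVb: list plumbing, block lemmas, and the cell-weight theorems

Venture CertifiedManyBodySolver, cell `pub/hubbard-downfold` (stage S1; INFLATION-RULES-3to1-B §B.81), seat hubbard-downfold-mod-4
(technique B, g33); namespace `Summit.Ventures.CertifiedManyBodySolver.Downfold.Emery`. Everything PROVED (0 sorry). WHAT THIS IS NOT: a
statement about any material; `U = 0` one-body kinematics of the σ model.

* `cell_weight_lo` / `cell_weight_hi`: under the parameter / level / shell / coarse-staircase checks, every point `k` of a fine cell with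
  `e₁ < ε_AB(k)` has its Cu weight inside the table entries of its coarse cell: `wl/10⁵ ≤ w_d(k) ≤ wh/10⁵` (shell index from the row
  codes + `Nat.floor`, harmonic range from the table corners, `abWeightK_mem_shell`, integer roundings `wLoZ_sound` / `wHiZ_sound`);
* the block lemmas (`sum_blocks`, `sum_rows6`, `cnt6_sixAt`) and list-sum plumbing; the assembled theorem is in
  `EmeryZoneOrbitalContentSound`.

Sources: [HybertsenSchluterChristensen1989, Eq. (1)]; [AndersenEtAl1995, §6]; Riemann sums / interval arithmetic [folklore] (Moore 1966).
-/

namespace Summit.Ventures.CertifiedManyBodySolver.Downfold.Emery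

open Real Set MeasureTheory Finset
open scoped ENNReal

/-! ## §7 List plumbing and block lemmas -/

/-- `((range n).map f).getD i d = f i` for `i < n` (local helper; the same fact is landed elsewhere in the tree). [folklore] -/
private theorem getD_range_map {α : Type*} (f : ℕ → α) (d : α) {n i : ℕ} (hi : i < n) : ((List.range n).map f).getD i d = f i := by
  rw [List.getD_eq_getElem _ _ (by simpa using hi)]
  simp

/-- List sum over `range n` is the `Finset` sum (local helper; landed elsewhere in the tree). [folklore] -/
private theorem list_range_map_sum (f : ℕ → ℤ) (n : ℕ) : ((List.range n).map f).sum = ∑ i ∈ Finset.range n, f i := by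
  induction n with
  | zero => simp
  | succ n ih => rw [List.range_succ, List.map_append, List.sum_append, ih, Finset.sum_range_succ]; simp

/-- `rowZ f = Σ_{J<64} f J`. [folklore] -/
theorem rowZ_eq (f : ℕ → ℤ) : rowZ f = ∑ J ∈ Finset.range 64, f J := list_range_map_sum f 64

/-- The block count is the number of `u < 6` with `jo ≤ 6J + u`. [folklore] -/
theorem cnt_eq_card (jo J : ℕ) : ((Finset.range 6).filter fun u => jo ≤ 6 * J + u).card = cnt jo J := by
  have e : ((Finset.range 6).filter fun u => jo ≤ 6 * J + u) = Finset.Ico (jo - 6 * J) 6 := by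
    ext u; simp only [Finset.mem_filter, Finset.mem_range, Finset.mem_Ico]; omega
  rw [e, Nat.card_Ico]; unfold cnt; omega

/-- **BLOCK LEMMA in the column index**: `Σ_{j<384} (if jo ≤ j then g (j/6) else 0) = Σ_{J<64} cnt(jo, J)·g J`. [folklore] -/
theorem sum_blocks (jo : ℕ) (g : ℕ → ℤ) :
    ∑ j ∈ Finset.range 384, (if jo ≤ j then g (j / 6) else 0) = ∑ J ∈ Finset.range 64, (cnt jo J : ℤ) * g J := by
  have split : ∀ n : ℕ, ∑ j ∈ Finset.range (6 * n), (if jo ≤ j then g (j / 6) else 0) =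
      ∑ J ∈ Finset.range n, ∑ u ∈ Finset.range 6, (if jo ≤ 6 * J + u then g ((6 * J + u) / 6) else 0) := by
    intro n
    induction n with
    | zero => simp
    | succ n ih =>
      rw [show 6 * (n + 1) = 6 * n + 6 from by ring, Finset.sum_range_add, ih]
      conv_rhs => rw [Finset.sum_range_succ]
  rw [show (384 : ℕ) = 6 * 64 from rfl, split 64]
  refine Finset.sum_congr rfl fun J _ => ?_
  have hdiv : ∀ u ∈ Finset.range 6, (6 * J + u) / 6 = J := by
    intro u hu; rw [Finset.mem_range] at hu; omega
  rw [Finset.sum_congr rfl fun u hu => by rw [hdiv u hu], ← cnt_eq_card, Finset.card_filter]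
  push_cast
  rw [Finset.sum_mul]
  refine Finset.sum_congr rfl fun u _ => ?_
  split_ifs <;> simp

/-- **BLOCK LEMMA in the row index**: `Σ_{i<384} F (i/6) (t i) = Σ_{I<64} Σ_{u<6} F I (t (6I + u))`. [folklore] -/
theorem sum_rows6 (F : ℕ → ℕ → ℤ) (t : ℕ → ℕ) :
    ∑ i ∈ Finset.range 384, F (i / 6) (t i) = ∑ I ∈ Finset.range 64, ∑ u ∈ Finset.range 6, F I (t (6 * I + u)) := by
  have split : ∀ n : ℕ, ∑ i ∈ Finset.range (6 * n), F (i / 6) (t i) =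
      ∑ I ∈ Finset.range n, ∑ u ∈ Finset.range 6, F ((6 * I + u) / 6) (t (6 * I + u)) := by
    intro n
    induction n with
    | zero => simp
    | succ n ih =>
      rw [show 6 * (n + 1) = 6 * n + 6 from by ring, Finset.sum_range_add, ih]
      conv_rhs => rw [Finset.sum_range_succ]
  rw [show (384 : ℕ) = 6 * 64 from rfl, split 64]
  refine Finset.sum_congr rfl fun I _ => Finset.sum_congr rfl fun u hu => ?_
  rw [Finset.mem_range] at hu
  congr 1; omega

/-- `sixAt thr I = [thr (6I), …, thr (6I+5)]` elementwise, for a list of length 384 and `I < 64`. [folklore] -/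
theorem sixAt_getD {thr : List ℕ} (hl : thr.length = 384) {I u : ℕ} (hI : I < 64) (hu : u < 6) :
    (sixAt thr I).getD u 0 = thr.getD (6 * I + u) 0 := by
  unfold sixAt
  rw [List.getD_eq_getElem _ _ (by simp [hl]; omega), List.getD_eq_getElem _ _ (by omega)]
  simp [List.getElem_take, List.getElem_drop]

/-- `cnt6 (sixAt thr I) J = Σ_{u<6} cnt (thr (6I+u)) J`. [folklore] -/
theorem cnt6_sixAt {thr : List ℕ} (hl : thr.length = 384) {I : ℕ} (hI : I < 64) (J : ℕ) :
    (cnt6 (sixAt thr I) J : ℤ) = ∑ u ∈ Finset.range 6, (cnt (thr.getD (6 * I + u) 0) J : ℤ) := by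
  have hlen : (sixAt thr I).length = 6 := by unfold sixAt; simp [hl]; omega
  have e : sixAt thr I = (List.range 6).map fun u => thr.getD (6 * I + u) 0 := by
    apply List.ext_getElem
    · simp [hlen]
    · intro n h1 h2
      have hn : n < 6 := by rw [hlen] at h1; exact h1
      have := sixAt_getD hl hI hn
      rw [List.getD_eq_getElem _ _ h1] at this
      simp [this]
  unfold cnt6
  rw [e, List.map_map]
  have : ((List.range 6).map ((fun jo => cnt jo J) ∘ fun u => thr.getD (6 * I + u) 0)).sum =
      ∑ u ∈ Finset.range 6, cnt (thr.getD (6 * I + u) 0) J := by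
    rw [← list_range_map_sum_nat]; rfl
  rw [this]; push_cast; rfl
where
  /-- ℕ version of the list-sum lemma. [folklore] -/
  list_range_map_sum_nat (f : ℕ → ℕ) (n : ℕ) : ((List.range n).map f).sum = ∑ i ∈ Finset.range n, f i := by
    induction n with
    | zero => simp
    | succ n ih => rw [List.range_succ, List.map_append, List.sum_append, ih, Finset.sum_range_succ]; simp

/-- `gmul n w = n·w`. [folklore] -/
theorem gmul_eq (n : ℕ) (w : ℤ) : gmul n w = (n : ℤ) * w := by
  unfold gmul; split_ifs with h <;> simp [h]

namespace ZoneCert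

variable {C : ZoneCert}

/-! ## §8 The weight of a hole point lies in its coarse cell's table entries -/

/-- The unpacked hypotheses of the cell-weight theorems. [folklore] -/
structure CellHyps (C : ZoneCert) : Prop where
  /-- `0 ≤ Δ` -/
  hΔ : 0 ≤ C.Δ
  /-- `0 ≤ t_pp′` -/
  hc : 0 ≤ C.c
  /-- `t_pp′ ≤ t_pp` -/
  hcb : C.c ≤ C.b
  /-- `0 < t_pd` -/
  ha : 0 < C.a
  /-- `0 < h` -/
  hh : 0 < C.h
  /-- `2 ≤ M` -/
  hM : 2 ≤ C.M
  /-- levels admissible -/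
  hLv : ∀ m', m' < C.M - 1 → levelOK C.Δ C.a C.b C.c (C.E (m' + 1)) = true
  /-- shells admissible -/
  hSh : ∀ m, m < C.M - 1 → shellOK C.Δ C.a C.b C.c (C.E m) C.h = true
  /-- coarse rows certified -/
  hCo : C.coarseOK = true

/-- Extract `CellHyps` from the boolean checks. [folklore] -/
theorem cellHyps_of (hP : C.paramOK = true) (hL : C.levelsOK = true) (hS : C.shellsOK = true) (hCo : C.coarseOK = true) :
    CellHyps C := by
  simp only [paramOK, Bool.and_eq_true, decide_eq_true_eq] at hP
  obtain ⟨⟨⟨⟨⟨⟨⟨⟨⟨⟨hΔ, hc⟩, hcb⟩, ha⟩, hh⟩, -⟩, -⟩, hM⟩, -⟩, -⟩, -⟩ := hP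
  simp only [levelsOK, Bool.and_eq_true, List.all_eq_true, List.mem_range] at hL
  simp only [shellsOK, List.all_eq_true, List.mem_range] at hS
  exact ⟨hΔ, hc, hcb, ha, hh, hM, fun m' hm' => hL.2 m' hm', fun m hm => hS m hm, hCo⟩

/-- The shell index bracket of a hole point in a coarse cell and its consequences: a shell `m < M − 1` with
`E_m ≤ ε_AB(k) ≤ E_m + h`, `mlo ≤ m < mhi`. [folklore] -/
theorem shell_of_hole_point (H : CellHyps C) {I J : ℕ} (hI : I < 64) (hJ : J < 64) {k : ℝ × ℝ} (hk : k ∈ cellIcc 64 (I, J))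
    (hek : (C.e1 : ℝ) < abEnergyK (C.Δ : ℝ) C.a C.b C.c k) :
    ∃ m : ℕ, m < C.M - 1 ∧ mloOf ((C.coarse.getD I []).map (· / 100)) J ≤ m ∧ m < mhiOf ((C.coarse.getD I []).map (· % 100)) J ∧
      ((C.E m : ℚ) : ℝ) ≤ abEnergyK (C.Δ : ℝ) C.a C.b C.c k ∧ abEnergyK (C.Δ : ℝ) C.a C.b C.c k ≤ ((C.E m : ℚ) : ℝ) + C.h := by
  have hCo := H.hCo
  simp only [coarseOK, Bool.and_eq_true, Bool.or_eq_true, List.all_eq_true, List.mem_range, decide_eq_true_eq] at hCo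
  obtain ⟨⟨hclen, hlast⟩, hrow⟩ := hCo I hI
  set codes := C.coarse.getD I [] with hcodes
  set cos := codes.map (· / 100) with hcos
  set cis := codes.map (· % 100) with hcis
  set ε := abEnergyK (C.Δ : ℝ) C.a C.b C.c k with hεdef
  have hhR : (0 : ℝ) < C.h := by exact_mod_cast H.hh
  have hE : ∀ m : ℕ, ((C.E m : ℚ) : ℝ) = (C.e1 : ℝ) + (m : ℝ) * C.h := fun m => by simp only [E]; push_cast; ring
  have hcos_len : cos.length = C.M - 1 := by simp [hcos, hclen]
  have hcis_len : cis.length = C.M - 1 := by simp [hcis, hclen]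
  have hcos_get : ∀ m', m' < C.M - 1 → cos.getD m' 0 = codes.getD m' 0 / 100 := fun m' hm' => by
    rw [hcos, List.getD_eq_getElem _ _ (by simp [hclen]; omega), List.getD_eq_getElem _ _ (by omega)]; simp
  have hcis_get : ∀ m', m' < C.M - 1 → cis.getD m' 0 = codes.getD m' 0 % 100 := fun m' hm' => by
    rw [hcis, List.getD_eq_getElem _ _ (by simp [hclen]; omega), List.getD_eq_getElem _ _ (by omega)]; simp
  have hM := H.hM
  -- lower level
  have hElo : ((C.E (mloOf cos J) : ℚ) : ℝ) ≤ ε := by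
    rcases mloOf_spec cos J with h0 | ⟨h1, h2, h3⟩
    · rw [h0, hE]; push_cast; linarith
    · have hm' : mloOf cos J - 1 < C.M - 1 := by rw [hcos_len] at h2; omega
      have hmlo1 : mloOf cos J - 1 + 1 = mloOf cos J := by omega
      obtain ⟨⟨⟨hco, -⟩, hout⟩, -⟩ := hrow (mloOf cos J - 1) hm'
      have hco' : codes.getD (mloOf cos J - 1) 0 / 100 ≤ J := by rw [← hcos_get _ hm']; exact h3
      rcases hout with h64 | hout
      · omega
      rw [levels, getD_range_map _ _ hm', hmlo1] at hout
      have hl : levelOK C.Δ C.a C.b C.c (C.E (mloOf cos J)) = true := by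
        have := H.hLv (mloOf cos J - 1) hm'; rwa [hmlo1] at this
      exact (coarse_hole_cell hl hI hco' hJ hout hk).le
  -- upper level
  obtain ⟨g1, g2, g3, g4⟩ := mhiOf_spec cis J
  have hmhiM : mhiOf cis J ≤ C.M - 1 := by
    by_contra hgt
    have heq : mhiOf cis J = cis.length + 1 := by omega
    have := g4 heq (C.M - 2) (by omega)
    rw [hcis_get _ (by omega), hlast] at this
    omega
  have hm' : mhiOf cis J - 1 < C.M - 1 := by omega
  have hmhi1 : mhiOf cis J - 1 + 1 = mhiOf cis J := by omega
  have hci : J < codes.getD (mhiOf cis J - 1) 0 % 100 := by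
    have := g3 (by omega)
    rwa [hcis_get _ hm'] at this
  obtain ⟨⟨⟨-, hci64⟩, -⟩, hin⟩ := hrow (mhiOf cis J - 1) hm'
  rcases hin with h0 | hin
  · omega
  rw [levels, getD_range_map _ _ hm', hmhi1] at hin
  have hl : levelOK C.Δ C.a C.b C.c (C.E (mhiOf cis J)) = true := by
    have := H.hLv (mhiOf cis J - 1) hm'; rwa [hmhi1] at this
  have hEhi : ε < ((C.E (mhiOf cis J) : ℚ) : ℝ) := coarse_occ_cell hl H.hΔ H.hc hI (by omega) hci64 hin hk
  -- the shell index
  set q : ℝ := (ε - C.e1) / C.h with hq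
  have hq0 : 0 ≤ q := by rw [hq]; exact div_nonneg (by linarith) hhR.le
  have hmq : (⌊q⌋₊ : ℝ) ≤ q := Nat.floor_le hq0
  have hqm : q < ⌊q⌋₊ + 1 := Nat.lt_floor_add_one q
  have hlt : ⌊q⌋₊ < mhiOf cis J := by
    refine (Nat.floor_lt hq0).2 ?_
    rw [hE] at hEhi; rw [hq, div_lt_iff₀ hhR]; linarith
  refine ⟨⌊q⌋₊, by omega, ?_, hlt, ?_, ?_⟩
  · refine Nat.le_floor ?_
    rw [hE] at hElo; rw [hq, le_div_iff₀ hhR]; linarith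
  · rw [hE]
    have : (⌊q⌋₊ : ℝ) * C.h ≤ ε - C.e1 := by rwa [hq, le_div_iff₀ hhR] at hmq
    linarith
  · rw [hE]
    have : ε - C.e1 < ((⌊q⌋₊ : ℝ) + 1) * C.h := by rwa [hq, div_lt_iff₀ hhR] at hqm
    linarith

/-- **CELL WEIGHT, LOWER**: `wtabLo(I, J)/10⁵ ≤ w_d(k)` for a hole point `k` of the coarse cell `(I, J)`. [folklore] -/
theorem cell_weight_lo (H : CellHyps C) {I J : ℕ} (hI : I < 64) (hJ : J < 64) {k : ℝ × ℝ} (hk : k ∈ cellIcc 64 (I, J))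
    (hek : (C.e1 : ℝ) < abEnergyK (C.Δ : ℝ) C.a C.b C.c k) (he1 : 0 < C.e1) :
    (((C.wtabLo.getD I []).getD J 0 : ℤ) : ℝ) / 100000 ≤ abWeightK (C.Δ : ℝ) C.a C.b C.c k := by
  obtain ⟨m, hmM, hlo, hhi, hEm, hmE⟩ := shell_of_hole_point H hI hJ hk hek
  obtain ⟨hSa0, hSa, hSb, hSb1⟩ := sRangeZ_sound hI hJ hk
  have hsh := H.hSh m hmM
  have htab : (C.wtabLo.getD I []).getD J 0 =
      cellWlo C.shells (mloOf ((C.coarse.getD I []).map (· / 100)) J) (mhiOf ((C.coarse.getD I []).map (· % 100)) J) (sRangeZ I J).1 := by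
    unfold wtabLo; simp only; rw [getD_range_map _ _ hI, getD_range_map _ _ hJ]
  have hshells : C.shells.getD m ⟨0, 0, 0, 0, 0⟩ = shellZ C.Δ C.a C.b C.c (C.E m) C.h := by
    unfold shells; rw [getD_range_map _ _ hmM]
  have hlen : m < C.shells.length := by unfold shells; simpa using hmM
  have hcell := cellWlo_spec C.shells hlo hhi hlen (sRangeZ I J).1
  rw [hshells] at hcell
  rw [htab]
  -- the real chain
  have hσb0 : (0 : ℝ) ≤ (((sRangeZ I J).2 : ℤ) : ℝ) / 1000000000 := le_trans (le_trans (by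
    have : (0:ℝ) ≤ (((sRangeZ I J).1 : ℤ) : ℝ) := by exact_mod_cast hSa0
    positivity) hSa) hSb
  have hSa1 : (sRangeZ I J).1 ≤ gN := by
    have : (((sRangeZ I J).1 : ℤ) : ℝ) / 1000000000 ≤ 1 := le_trans (hSa.trans hSb) (by
      have : (((sRangeZ I J).2 : ℤ) : ℝ) ≤ 1000000000 := by have := hSb1; simp only [gN] at this; exact_mod_cast this
      linarith [div_le_one_of_le₀ this (by norm_num : (0:ℝ) ≤ 1000000000)])
    have : (((sRangeZ I J).1 : ℤ) : ℝ) ≤ 1000000000 := by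
      by_contra hgt
      have hgt' : 1000000000 < (((sRangeZ I J).1 : ℤ) : ℝ) := lt_of_not_ge hgt
      have : 1 < (((sRangeZ I J).1 : ℤ) : ℝ) / 1000000000 := by rw [lt_div_iff₀ (by norm_num)]; linarith
      linarith
    simp only [gN]; exact_mod_cast this
  have hσ := abWeightK_mem_shell H.hcb H.ha H.hh.le hsh hEm hmE
    (by have : (0:ℝ) ≤ (((sRangeZ I J).1 : ℤ) : ℝ) := by exact_mod_cast hSa0
        positivity) hSa hSb
    (by have : (((sRangeZ I J).2 : ℤ) : ℝ) ≤ 1000000000 := by have := hSb1; simp only [gN] at this; exact_mod_cast this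
        exact div_le_one_of_le₀ this (by norm_num))
  have hZ := wLoZ_sound hsh H.hh.le hSa0 hSa1
  have hw0 : 0 ≤ abWeightK (C.Δ : ℝ) C.a C.b C.c k :=
    abWeightK_nonneg (by exact_mod_cast H.hΔ) (by exact_mod_cast H.hc) (by exact_mod_cast (H.hc.trans H.hcb))
      (lt_trans (by exact_mod_cast he1) hek)
  have h1 : ((max 0 (wLoZ (shellZ C.Δ C.a C.b C.c (C.E m) C.h) (sRangeZ I J).1) : ℤ) : ℝ) / 100000 ≤
      abWeightK (C.Δ : ℝ) C.a C.b C.c k := by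
    rcases le_total 0 (wLoZ (shellZ C.Δ C.a C.b C.c (C.E m) C.h) (sRangeZ I J).1) with hp | hn
    · rw [max_eq_right hp]; linarith [hσ.1]
    · rw [max_eq_left hn]; simpa using hw0
  have h2 : ((cellWlo C.shells (mloOf ((C.coarse.getD I []).map (· / 100)) J) (mhiOf ((C.coarse.getD I []).map (· % 100)) J)
      (sRangeZ I J).1 : ℤ) : ℝ) ≤ ((max 0 (wLoZ (shellZ C.Δ C.a C.b C.c (C.E m) C.h) (sRangeZ I J).1) : ℤ) : ℝ) := by
    exact_mod_cast hcell
  linarith [div_le_div_of_nonneg_right h2 (by norm_num : (0:ℝ) ≤ 100000)]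

/-- **CELL WEIGHT, UPPER**: `w_d(k) ≤ wtabHi(I, J)/10⁵` for a hole point `k` of the coarse cell `(I, J)`. [folklore] -/
theorem cell_weight_hi (H : CellHyps C) {I J : ℕ} (hI : I < 64) (hJ : J < 64) {k : ℝ × ℝ} (hk : k ∈ cellIcc 64 (I, J))
    (hek : (C.e1 : ℝ) < abEnergyK (C.Δ : ℝ) C.a C.b C.c k) (he1 : 0 < C.e1) :
    abWeightK (C.Δ : ℝ) C.a C.b C.c k ≤ (((C.wtabHi.getD I []).getD J 0 : ℤ) : ℝ) / 100000 := by
  obtain ⟨m, hmM, hlo, hhi, hEm, hmE⟩ := shell_of_hole_point H hI hJ hk hek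
  obtain ⟨hSa0, hSa, hSb, hSb1⟩ := sRangeZ_sound hI hJ hk
  have hsh := H.hSh m hmM
  have htab : (C.wtabHi.getD I []).getD J 0 =
      cellWhi C.shells (mloOf ((C.coarse.getD I []).map (· / 100)) J) (mhiOf ((C.coarse.getD I []).map (· % 100)) J) (sRangeZ I J).2 := by
    unfold wtabHi; simp only; rw [getD_range_map _ _ hI, getD_range_map _ _ hJ]
  have hshells : C.shells.getD m ⟨0, 0, 0, 0, 0⟩ = shellZ C.Δ C.a C.b C.c (C.E m) C.h := by
    unfold shells; rw [getD_range_map _ _ hmM]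
  have hlen : m < C.shells.length := by unfold shells; simpa using hmM
  have hcell := cellWhi_spec C.shells hlo hhi hlen (sRangeZ I J).2
  rw [hshells] at hcell
  rw [htab]
  have hSb0 : 0 ≤ (sRangeZ I J).2 := by
    have : (0 : ℝ) ≤ (((sRangeZ I J).2 : ℤ) : ℝ) / 1000000000 := le_trans (le_trans (by
      have : (0:ℝ) ≤ (((sRangeZ I J).1 : ℤ) : ℝ) := by exact_mod_cast hSa0
      positivity) hSa) hSb
    have : (0 : ℝ) ≤ (((sRangeZ I J).2 : ℤ) : ℝ) := by
      by_contra hlt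
      have hlt' : (((sRangeZ I J).2 : ℤ) : ℝ) < 0 := lt_of_not_ge hlt
      have : (((sRangeZ I J).2 : ℤ) : ℝ) / 1000000000 < 0 := div_neg_of_neg_of_pos hlt' (by norm_num)
      linarith
    exact_mod_cast this
  have hσ := abWeightK_mem_shell H.hcb H.ha H.hh.le hsh hEm hmE
    (by have : (0:ℝ) ≤ (((sRangeZ I J).1 : ℤ) : ℝ) := by exact_mod_cast hSa0
        positivity) hSa hSb
    (by have : (((sRangeZ I J).2 : ℤ) : ℝ) ≤ 1000000000 := by have := hSb1; simp only [gN] at this; exact_mod_cast this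
        exact div_le_one_of_le₀ this (by norm_num))
  have hZ := wHiZ_sound hsh H.hh.le hSb0 hSb1
  have hw1 : abWeightK (C.Δ : ℝ) C.a C.b C.c k ≤ 1 :=
    abWeightK_le_one (by exact_mod_cast H.hΔ) (by exact_mod_cast H.hc) (by exact_mod_cast (H.hc.trans H.hcb))
      (lt_trans (by exact_mod_cast he1) hek)
  have h1 : abWeightK (C.Δ : ℝ) C.a C.b C.c k ≤
      ((min wW (wHiZ (shellZ C.Δ C.a C.b C.c (C.E m) C.h) (sRangeZ I J).2) : ℤ) : ℝ) / 100000 := by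
    rcases le_total wW (wHiZ (shellZ C.Δ C.a C.b C.c (C.E m) C.h) (sRangeZ I J).2) with hp | hn
    · rw [min_eq_left hp]; simp [wW]; linarith
    · rw [min_eq_right hn]
      have hd := shellDelta_nonneg_aux hsh H.hh.le
      linarith [hσ.2]
  have h2 : ((min wW (wHiZ (shellZ C.Δ C.a C.b C.c (C.E m) C.h) (sRangeZ I J).2) : ℤ) : ℝ) ≤
      ((cellWhi C.shells (mloOf ((C.coarse.getD I []).map (· / 100)) J) (mhiOf ((C.coarse.getD I []).map (· % 100)) J)
        (sRangeZ I J).2 : ℤ) : ℝ) := by exact_mod_cast hcell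
  linarith [div_le_div_of_nonneg_right h2 (by norm_num : (0:ℝ) ≤ 100000)]
  where
    /-- `δ ≥ 0` for an admissible shell. [folklore] -/
    shellDelta_nonneg_aux {Δ a b c E h : ℚ} (hs : shellOK Δ a b c E h = true) (hh : 0 ≤ h) :
        0 ≤ shellDelta (Δ : ℝ) a b c E h := by
      obtain ⟨hDlo, -, -, -, -⟩ := shellOK_spec hs
      have hhR : (0 : ℝ) ≤ h := by exact_mod_cast hh
      have hT : 0 ≤ shellDtail (Δ : ℝ) a b c E h := by
        unfold shellDtail; exact add_nonneg (Sext.absTail_nonneg _ hhR) (Sext.absTail_nonneg _ hhR)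
      have hDamin : 0 < shellDamin (Δ : ℝ) a b c E := by unfold shellDlo at hDlo; linarith
      have hQ : 0 ≤ shellQmax (Δ : ℝ) a b c E h := by unfold shellQmax qAbs; positivity
      unfold shellDelta; positivity

end ZoneCert

end Summit.Ventures.CertifiedManyBodySolver.Downfold.Emery
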